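import Mathlib
import Summits.ResolutionOfSingularities.ResolutionOfSingularities.Theorems.RadicialJungCleanModelsCleanPatchingDefs
import Summits.ResolutionOfSingularities.ResolutionOfSingularities.Theorems.RadicialJungCleanModelsCleanPatchingDomination
import Summits.ResolutionOfSingularities.ResolutionOfSingularities.Theorems.RadicialJungCleanModelsCleanChartModel
import Summits.ResolutionOfSingularities.ResolutionOfSingularities.Theorems.RadicialJungCleanModelsCleanResolvingSystem
import Literature.AlgebraicGeometry.Resolution.ResolvingSystems
import HarnessLib

/-!
# Route `RadicialJung`, crux `CleanModels` (stmt-ResolutionOfSingularities-15917), line `Sketch` rev 35, stub 7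
# `stub_cleanModelsDimGEFour`: a finite CLEAN RESOLVING SYSTEM over a family of regular charts, patched — EVERY DIMENSION
# (the dimension-free form of `RadicialJungCleanModelsCleanResolvingSystem.lean`)

Zariski's compactness-and-patching argument (Zariski–Samuel II, Ch. VI §17, Thm. 40; Piltant 2013, Cor. 5.7;
Cossart–Piltant 2019, proof of Prop. 4.6, Step 3) for the regularity property `P_clean(g₀)` of
`RadicialJungCleanModelsCleanPatchingDefs.lean` (`CleanRegAt` / `ModelCleanRegAt`), RELATIVE to a finite family of regular affine
`d`-dimensional charts `Aᵢ ⊆ K`: the landed `exists_model_cleanOn_over_charts` is the case `d = 3`, and NOTHING in its proof is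
three-dimensional — the dimension only threads through the clean-charts hypothesis `hcharts`.  This file records the statement with
`3` replaced by a natural number `d` (`exists_model_cleanOn_over_charts_dim`), proof verbatim: the valuations centred on some `Aᵢ`
form a quasi-compact subset of `Zar(K/k)` (`isCompact_biInter_basicOpen`); each carries a clean chart (hypothesis `hcharts`), whose
projective closure has an open of clean-regular points containing all nearby centres (`exists_model_cleanOn_of_cleanChart`); finitely
many suffice, and the open-form two-model patching for `P_clean` (hypothesis `hZ`) patches them over any `M₀`
(`exists_dominating_cleanOn`).  Consumer: `RadicialJungCleanModelsCleanGlobalizationDim.lean` (the frontier stub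
`stub_cleanModelsDimGEFour` from clean charts + two-model patching in dimension `≥ 4`).  PROVED; bookkeeping; nothing here proves
resolution in characteristic `p`; two-model patching itself is OPEN in dimension `≥ 4` (Piltant 2013, p. 2).
-/

noncomputable section

set_option linter.dupNamespace false -- mandated namespace of this single-conjunct summit

open CategoryTheory AlgebraicGeometry IsLocalRing
open Literature.AlgebraicGeometry.Resolution

namespace Summit.ResolutionOfSingularities.ResolutionOfSingularities.Theorems.RadicialJung.CleanModels

variable {k K : Type} [Field k] [Field K] [Algebra k K] {p : ℕ} {g₀ : K}

/-- **A finite clean resolving system, patched — any dimension `d`** (see the module docstring; the landed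
`exists_model_cleanOn_over_charts` is `d = 3`). [cite: Piltant2013, Cor. 5.7] -/
theorem exists_model_cleanOn_over_charts_dim {d : ℕ}
    (hcharts : ∀ (O : ValuationSubring K) (A : Subalgebra k K), A.toSubring ≤ O.toSubring → A.FG → IsFractionRing A K →
      ringKrullDim A ≤ (d : WithBot ℕ∞) →
      (∀ (𝔪 : Ideal A.toSubring) [𝔪.IsMaximal],
        IsRegularLocalRing (Localization.AtPrime 𝔪) ∧ ringKrullDim (Localization.AtPrime 𝔪) = (d : WithBot ℕ∞)) →
      ∃ T : Subalgebra k K, T.FG ∧ A ≤ T ∧ T.toSubring ≤ O.toSubring ∧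
        ∀ O' : ValuationSubring K, T.toSubring ≤ O'.toSubring → CleanRegAt p (locAtCentre T.toSubring O').subtype g₀)
    (hZ : ∀ (M₁ M₂ : ProjModel k K) (U₁ : M₁.X.Opens) (U₂ : M₂.X.Opens),
      (∀ x ∈ U₁, ModelCleanRegAt p g₀ M₁ x) → (∀ x ∈ U₂, ModelCleanRegAt p g₀ M₂ x) →
      ∃ (N : ProjModel k K) (φ₁ : N.Hom M₁) (φ₂ : N.Hom M₂),
        (∀ y : N.X, φ₁.f y ∈ U₁ → ModelCleanRegAt p g₀ N y) ∧ (∀ y : N.X, φ₂.f y ∈ U₂ → ModelCleanRegAt p g₀ N y))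
    {ι : Type} [Finite ι] (A : ι → Subalgebra k K) (hfg : ∀ i, (A i).FG) (hfr : ∀ i, IsFractionRing (A i) K)
    (hdim : ∀ i, ringKrullDim (A i) ≤ (d : WithBot ℕ∞))
    (hmax : ∀ i, ∀ (𝔪 : Ideal (A i).toSubring) [𝔪.IsMaximal],
      IsRegularLocalRing (Localization.AtPrime 𝔪) ∧ ringKrullDim (Localization.AtPrime 𝔪) = (d : WithBot ℕ∞))
    (M₀ : ProjModel k K) :
    ∃ (N : ProjModel k K) (_ : N.Hom M₀) (V : N.X.Opens), (∀ y ∈ V, ModelCleanRegAt p g₀ N y) ∧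
      ∀ v : ZariskiRiemannSpace k K, (∃ i, (A i).toSubring ≤ v.asValuationSubring.toSubring) → N.centre v ∈ V := by
  classical
  -- the valuations centred on some chart
  let Z : Set (ZariskiRiemannSpace k K) := {v | ∃ i, (A i).toSubring ≤ v.asValuationSubring.toSubring}
  -- `Z` is quasi-compact
  have hZc : IsCompact Z := by
    have hgen : ∀ i, ∃ s : Finset K, Algebra.adjoin k (s : Set K) = A i := fun i => hfg i
    choose s hs using hgen
    have hZeq : Z = ⋃ i, ⋂ x ∈ s i, ZariskiRiemannSpace.basicOpen x := by
      ext v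
      simp only [Z, Set.mem_setOf_eq, Set.mem_iUnion]
      refine exists_congr fun i => ?_
      rw [← hs i]
      have := setOf_le_eq_biInter (k := k) (K := K) (s i)
      exact Set.ext_iff.mp this v
    rw [hZeq]
    exact isCompact_iUnion fun i => ZariskiRiemannSpace.isCompact_biInter_basicOpen (s i)
  -- a clean chart inside every `v ∈ Z`
  have key : ∀ v : Z, ∃ T : Subalgebra k K, T.FG ∧ IsFractionRing T K ∧
      T.toSubring ≤ v.1.asValuationSubring.toSubring ∧
      ∀ O' : ValuationSubring K, T.toSubring ≤ O'.toSubring → CleanRegAt p (locAtCentre T.toSubring O').subtype g₀ := by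
    rintro ⟨v, i, hi⟩
    haveI := hfr i
    obtain ⟨T, hTfg, hAT, hTO, hT⟩ := hcharts v.asValuationSubring (A i) hi (hfg i) (hfr i) (hdim i) (hmax i)
    exact ⟨T, hTfg, isFractionRing_of_le hAT (hfr i), hTO, hT⟩
  choose T hTfg hTfr hTv hT using key
  -- its projective closure
  have key2 : ∀ v : Z, ∃ (M : ProjModel k K) (U : M.X.Opens), (∀ x ∈ U, ModelCleanRegAt p g₀ M x) ∧
      ∀ w : ZariskiRiemannSpace k K, (T v).toSubring ≤ w.asValuationSubring.toSubring → M.centre w ∈ U := by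
    intro v
    haveI := hTfr v
    exact exists_model_cleanOn_of_cleanChart (T v) (hTfg v) (hT v)
  choose M U hMclean hcenU using key2
  -- the open neighbourhoods `W v = {w | T v ⊆ 𝒪_w}` cover `Z`
  let Wv : Z → Set (ZariskiRiemannSpace k K) := fun v => {w | (T v).toSubring ≤ w.asValuationSubring.toSubring}
  have hWo : ∀ v, IsOpen (Wv v) := by
    intro v
    obtain ⟨s, hs⟩ := hTfg v
    have : Wv v = ⋂ x ∈ s, ZariskiRiemannSpace.basicOpen x := by
      rw [← setOf_le_eq_biInter (k := k) (K := K) s, hs]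
    rw [this]
    exact isOpen_biInter_finset fun x _ => ZariskiRiemannSpace.isOpen_basicOpen x
  have hcover : Z ⊆ ⋃ v : Z, Wv v := fun v hv => Set.mem_iUnion.mpr ⟨⟨v, hv⟩, hTv ⟨v, hv⟩⟩
  obtain ⟨t, ht⟩ := hZc.elim_finite_subcover Wv hWo hcover
  -- patch the finitely many models
  let l : List (Σ N : ProjModel k K, N.X.Opens) := t.toList.map fun v => ⟨M v, U v⟩
  have hl : ∀ MU ∈ l, ∀ x ∈ MU.2, ModelCleanRegAt p g₀ MU.1 x := by
    intro MU hMU x hx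
    obtain ⟨v, -, rfl⟩ := List.mem_map.mp hMU
    exact hMclean v x hx
  obtain ⟨N, ψ, V, hV, hcen⟩ := exists_dominating_cleanOn hZ M₀ l hl
  refine ⟨N, ψ, V, hV, fun v hv => hcen v ?_⟩
  have hvZ : v ∈ Z := hv
  obtain ⟨v₀, hv₀t, hvW⟩ := Set.mem_iUnion₂.mp (ht hvZ)
  exact ⟨⟨M v₀, U v₀⟩, List.mem_map.mpr ⟨v₀, Finset.mem_toList.mpr hv₀t, rfl⟩, hcenU v₀ v hvW⟩

end Summit.ResolutionOfSingularities.ResolutionOfSingularities.Theorems.RadicialJung.CleanModels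

end
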